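import Literature.GroupTheory.CombinatorialGroupTheory.RandomSclFreeGroupTripods
import Literature.GroupTheory.CombinatorialGroupTheory.RandomSclFreeGroupLowerBound
import HarnessLib

/-!
# Random rigidity of scl (Calegari–Walker 2013): proofs, part 16 — assembling tripods

D. Calegari, A. Walker, *Random rigidity in the free group*, Geom. Topol. 17 (2013)
[CalegariWalker2013], §4.2–§4.3 (proof of Prop. 4.2). A *tripod copy* in a word `v` is a triple
of corners `c₀, c₁, c₂` (positions of `v`) such that for each `i` the `ℓ + 1` letters after
`c_{i-1}` (the outgoing side of prong `i`) are the inverse of the `ℓ + 1` letters before `cᵢ`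
(the incoming side of prong `i`); two prongs are *glued along a joint* when the incoming side of
each is the outgoing side of the other (loc. cit. §4.2, the involution `ι` on joints). Given any
family of tripod copies and any partial gluing `g` of their prongs, the fatgraph of loc. cit.
§4.3 bounds `N'` copies of `v`, where `N'` is the maximal number of prong sides over a letter of
`v`: the "rectangles" (sides, remembered with their positions) are arranged into `N'` strips each
reading `v` — at the letter level a strip is a copy of `v` inside `W = v^{N'}` and the arrangement
is a *level* `< N'` for every side such that two sides on the same level are disjoint and the
outgoing side at a tripod corner sits on the level of the incoming side it follows
(**`exists_levels`**, greedy colouring of an interval graph with prescribed successors: "it is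
possible to glue up the red segments in pairs compatibly", loc. cit.). The Euler characteristic
is then computed by `commutatorLength_le_of_tripodSystem`:

* **`four_mul_cl_pow_le_of_tripods`** —
  `4 cl(v^{N'}) + ℓ (3T + U) + 2T ≤ N' n + 2`, `T` = number of tripods, `U` = number of unglued
  prongs. For a complete cubic gluing with exact coverage (`U = 0`, `N' n = 3(ℓ+1)T`) this reads
  `4 cl(v^{N'}) ≤ T + 2`, i.e. `scl(v) ≲ n/(12(ℓ+1))`, which is `log(2k−1)/6 · n/log n` for
  `ℓ + 1 ≈ m/2`, `m = log n / log(2k−1)` (loc. cit. Lemma 3.7 with average edge length `m/2`).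
* **`four_mul_cl_pow_le_of_gluedTripods`** — the variant in which unglued prongs are discarded
  (no sides, no credit for their tripods): `4 cl(v^{N'}) + ℓ (3T − U) + 2T ≤ N' n + 2 + 2U`
  under the coverage hypothesis for incoming sides only.
-/

namespace Literature.GroupTheory.CombinatorialGroupTheory

section Levels

/-- **Levels for intervals with prescribed successors.** Intervals `[start σ, start σ + len σ)`
(`len σ > 0`) indexed by a finite type, with a partial injective "successor" map `succ` such that
the successor of `σ` starts where `σ` ends. If every point is covered by at most `N` intervals,
there is a level map `ι → Fin N` such that distinct intervals on the same level are disjoint and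
every interval has the same level as its successor. [cite: CalegariWalker2013, §4.3] -/
theorem exists_levels {ι : Type*} [Fintype ι] [DecidableEq ι] (start len : ι → ℕ)
    (hlen : ∀ σ, 0 < len σ) (succ : ι → Option ι)
    (hinj : ∀ σ σ' τ, succ σ = some τ → succ σ' = some τ → σ = σ')
    (hpos : ∀ σ τ, succ σ = some τ → start τ = start σ + len σ) (N : ℕ)
    (hcov : ∀ p : ℕ,
      (Finset.univ.filter fun σ => start σ ≤ p ∧ p < start σ + len σ).card ≤ N) :
    ∃ level : ι → Fin N,
      (∀ σ σ', σ ≠ σ' → level σ = level σ' →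
        start σ + len σ ≤ start σ' ∨ start σ' + len σ' ≤ start σ) ∧
      (∀ σ τ, succ σ = some τ → level σ = level τ) := by
  classical
  -- a default level map (needed to start the induction)
  have hdef : ∃ _d : ι → Fin N, True := by
    rcases isEmpty_or_nonempty ι with hι | ⟨⟨σ₀⟩⟩
    · exact ⟨isEmptyElim, trivial⟩
    · have h1 : 1 ≤ (Finset.univ.filter fun σ => start σ ≤ start σ₀ ∧
          start σ₀ < start σ + len σ).card :=
        Finset.card_pos.mpr ⟨σ₀, Finset.mem_filter.mpr ⟨Finset.mem_univ _, le_rfl,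
          Nat.lt_add_of_pos_right (hlen σ₀)⟩⟩
      have hN : 0 < N := lt_of_lt_of_le h1 (hcov _)
      exact ⟨fun _ => ⟨0, hN⟩, trivial⟩
  obtain ⟨d, -⟩ := hdef
  -- processing key: by left end point, intervals with a predecessor first
  let hasPred : ι → Prop := fun σ => ∃ σ', succ σ' = some σ
  let key : ι → ℕ := fun σ => 2 * start σ + if hasPred σ then 0 else 1
  have hkey_start : ∀ σ σ', start σ' < start σ → key σ' < key σ := by
    intro σ σ' h
    simp only [key]
    split_ifs <;> omega
  have hkey_le : ∀ σ σ', key σ' ≤ key σ → start σ' ≤ start σ := by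
    intro σ σ' h
    simp only [key] at h
    split_ifs at h <;> omega
  have hkey_pred : ∀ σ σ', key σ' ≤ key σ → start σ' = start σ → hasPred σ → hasPred σ' := by
    intro σ σ' h hs hp
    by_contra hp'
    simp only [key, if_pos hp, if_neg hp'] at h
    omega
  have hkey_succ : ∀ σ τ, succ σ = some τ → key σ < key τ := by
    intro σ τ h
    exact hkey_start τ σ (by rw [hpos σ τ h]; exact Nat.lt_add_of_pos_right (hlen σ))
  -- overlap
  let ov : ι → ι → Prop := fun a b => start b < start a + len a ∧ start a < start b + len b
  -- the invariant on an initial segment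
  let Inv : Finset ι → (ι → Fin N) → Prop := fun S level =>
    (∀ a ∈ S, ∀ b ∈ S, a ≠ b → level a = level b → ¬ ov a b) ∧
    (∀ a ∈ S, ∀ τ ∈ S, succ a = some τ → level a = level τ)
  have main : ∀ m : ℕ, ∀ S : Finset ι, S.card = m →
      (∀ σ ∈ S, ∀ σ', key σ' < key σ → σ' ∈ S) → ∃ level : ι → Fin N, Inv S level := by
    intro m
    induction m with
    | zero =>
      intro S hS _
      rw [Finset.card_eq_zero] at hS
      subst hS
      exact ⟨d, by simp [Inv]⟩
    | succ m ih =>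
      intro S' hS' hinit
      have hne : S'.Nonempty := by
        rw [← Finset.card_pos, hS']; omega
      obtain ⟨σ, hσS', hσmax⟩ := Finset.exists_max_image S' key hne
      set S := S'.erase σ with hSdef
      have hScard : S.card = m := by
        rw [hSdef, Finset.card_erase_of_mem hσS', hS']; rfl
      have hSinit : ∀ τ ∈ S, ∀ σ', key σ' < key τ → σ' ∈ S := by
        intro τ hτ σ' hlt
        rw [hSdef, Finset.mem_erase] at hτ ⊢
        refine ⟨?_, hinit τ hτ.2 σ' hlt⟩
        rintro rfl
        exact absurd (hσmax τ hτ.2) (not_le.mpr hlt)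
      obtain ⟨level, hI1, hI2⟩ := ih S hScard hSinit
      have hmemS : ∀ b, b ∈ S ↔ b ∈ S' ∧ b ≠ σ := fun b => by
        rw [hSdef, Finset.mem_erase]; tauto
      -- every `b ∈ S'` starts at or before `σ`
      have hstart_le : ∀ b ∈ S', start b ≤ start σ := fun b hb => hkey_le σ b (hσmax b hb)
      -- `σ` has no successor inside `S'`
      have hnosucc : ∀ τ ∈ S', succ σ ≠ some τ := by
        intro τ hτ h
        exact absurd (hσmax τ hτ) (not_le.mpr (hkey_succ σ τ h))
      by_cases hp : hasPred σ
      · -- Case A: `σ` inherits the level of its predecessor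
        obtain ⟨σp, hσp⟩ := hp
        have hkσp : key σp < key σ := hkey_succ σp σ hσp
        have hσpS : σp ∈ S := by
          rw [hmemS]
          refine ⟨hinit σ hσS' σp hkσp, ?_⟩
          rintro rfl
          exact lt_irrefl _ hkσp
        have hσpne : σp ≠ σ := ((hmemS σp).mp hσpS).2
        have hend : start σp + len σp = start σ := (hpos σp σ hσp).symm
        refine ⟨Function.update level σ (level σp), ?_, ?_⟩
        · -- disjointness on a level
          have key_fact : ∀ b ∈ S, level b = level σp → ¬ ov σ b := by
            intro b hb hlb hov
            obtain ⟨hbS', hbne⟩ := (hmemS b).mp hb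
            have hbs := hstart_le b hbS'
            rcases Nat.lt_or_ge (start b) (start σ) with hlt | hge
            · -- `b` starts before `σ` and overlaps it, so it overlaps `σp`
              by_cases hbp : b = σp
              · subst hbp
                exact absurd hov.2 (by rw [hend]; exact lt_irrefl _)
              · refine hI1 b hb σp hσpS hbp hlb ⟨?_, ?_⟩
                · have := hov.2; omega
                · have := hlen σp; omega
            · -- `b` starts at `σ`: it has a predecessor of its own
              have hbeq : start b = start σ := le_antisymm hbs hge
              have hbpred : hasPred b :=
                hkey_pred σ b (hσmax b hbS') hbeq ⟨σp, hσp⟩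
              obtain ⟨bp, hbp⟩ := hbpred
              have hkbp : key bp < key b := hkey_succ bp b hbp
              have hbpS : bp ∈ S := by
                rw [hmemS]
                refine ⟨hinit b hbS' bp hkbp, ?_⟩
                rintro rfl
                exact absurd (hσmax b hbS') (not_le.mpr hkbp)
              have hlev : level bp = level b := hI2 bp hbpS b hb hbp
              have hne' : bp ≠ σp := by
                rintro rfl
                exact hbne ((Option.some.inj (hbp.symm.trans hσp)))
              have hendb : start bp + len bp = start σ := by rw [← hbeq]; exact (hpos bp b hbp).symm
              have h1 := hlen bp
              have h2 := hlen σp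
              refine hI1 bp hbpS σp hσpS hne' (hlev.trans hlb) ⟨?_, ?_⟩
              · omega
              · omega
          intro a ha b hb hab hl
          by_cases haσ : a = σ
          · subst haσ
            have hbσ : b ≠ a := fun h => hab h.symm
            rw [Function.update_self, Function.update_of_ne hbσ] at hl
            have hbS : b ∈ S := (hmemS b).mpr ⟨hb, hbσ⟩
            exact key_fact b hbS hl.symm
          · by_cases hbσ : b = σ
            · subst hbσ
              rw [Function.update_self, Function.update_of_ne haσ] at hl
              have haS : a ∈ S := (hmemS a).mpr ⟨ha, haσ⟩
              intro hov
              exact key_fact a haS hl ⟨hov.2, hov.1⟩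
            · rw [Function.update_of_ne haσ, Function.update_of_ne hbσ] at hl
              exact hI1 a ((hmemS a).mpr ⟨ha, haσ⟩) b ((hmemS b).mpr ⟨hb, hbσ⟩) hab hl
        · -- successors
          intro a ha τ hτ hsucc
          by_cases hτσ : τ = σ
          · subst hτσ
            have haeq : a = σp := hinj a σp τ hsucc hσp
            subst haeq
            rw [Function.update_self, Function.update_of_ne hσpne]
          · by_cases haσ : a = σ
            · subst haσ
              exact absurd hsucc (hnosucc τ hτ)
            · rw [Function.update_of_ne haσ, Function.update_of_ne hτσ]
              exact hI2 a ((hmemS a).mpr ⟨ha, haσ⟩) τ ((hmemS τ).mpr ⟨hτ, hτσ⟩) hsucc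
      · -- Case B: a fresh level, not used by the processed intervals meeting `σ`
        set blocked : Finset (Fin N) := (S.filter fun b => ov σ b).image level with hblocked
        have hsub : insert σ (S.filter fun b => ov σ b) ⊆
            Finset.univ.filter fun b => start b ≤ start σ ∧ start σ < start b + len b := by
          intro b hb
          rw [Finset.mem_insert] at hb
          rw [Finset.mem_filter]
          refine ⟨Finset.mem_univ _, ?_⟩
          rcases hb with rfl | hb
          · exact ⟨le_rfl, Nat.lt_add_of_pos_right (hlen b)⟩
          · rw [Finset.mem_filter] at hb
            obtain ⟨hbS, hov⟩ := hb
            exact ⟨hstart_le b ((hmemS b).mp hbS).1, hov.2⟩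
        have hσnot : σ ∉ S.filter fun b => ov σ b := by
          intro h
          rw [Finset.mem_filter] at h
          exact ((hmemS σ).mp h.1).2 rfl
        have hcard : blocked.card < (Finset.univ : Finset (Fin N)).card := by
          rw [Finset.card_univ, Fintype.card_fin]
          have h1 := Finset.card_le_card hsub
          rw [Finset.card_insert_of_notMem hσnot] at h1
          have h2 := hcov (start σ)
          calc blocked.card ≤ (S.filter fun b => ov σ b).card := Finset.card_image_le
            _ < N := by omega
        obtain ⟨c, -, hc⟩ := Finset.exists_mem_notMem_of_card_lt_card hcard
        have hcfree : ∀ b ∈ S, level b = c → ¬ ov σ b := by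
          intro b hb hlb hov
          apply hc
          rw [hblocked, Finset.mem_image]
          exact ⟨b, Finset.mem_filter.mpr ⟨hb, hov⟩, hlb⟩
        refine ⟨Function.update level σ c, ?_, ?_⟩
        · intro a ha b hb hab hl
          by_cases haσ : a = σ
          · subst haσ
            have hbσ : b ≠ a := fun h => hab h.symm
            rw [Function.update_self, Function.update_of_ne hbσ] at hl
            exact hcfree b ((hmemS b).mpr ⟨hb, hbσ⟩) hl.symm
          · by_cases hbσ : b = σ
            · subst hbσ
              rw [Function.update_self, Function.update_of_ne haσ] at hl
              intro hov
              exact hcfree a ((hmemS a).mpr ⟨ha, haσ⟩) hl ⟨hov.2, hov.1⟩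
            · rw [Function.update_of_ne haσ, Function.update_of_ne hbσ] at hl
              exact hI1 a ((hmemS a).mpr ⟨ha, haσ⟩) b ((hmemS b).mpr ⟨hb, hbσ⟩) hab hl
        · intro a ha τ hτ hsucc
          by_cases hτσ : τ = σ
          · subst hτσ
            exact absurd ⟨a, hsucc⟩ hp
          · by_cases haσ : a = σ
            · subst haσ
              exact absurd hsucc (hnosucc τ hτ)
            · rw [Function.update_of_ne haσ, Function.update_of_ne hτσ]
              exact hI2 a ((hmemS a).mpr ⟨ha, haσ⟩) τ ((hmemS τ).mpr ⟨hτ, hτσ⟩) hsucc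
  -- apply to the whole index type
  obtain ⟨level, hI1, hI2⟩ := main _ Finset.univ rfl (fun _ _ _ _ => Finset.mem_univ _)
  refine ⟨level, fun a b hab hl => ?_, fun a τ h => hI2 a (Finset.mem_univ _) τ (Finset.mem_univ _) h⟩
  have h := hI1 a (Finset.mem_univ _) b (Finset.mem_univ _) hab hl
  simp only [ov, not_and_or, not_lt] at h
  rcases h with h | h
  · exact Or.inl h
  · exact Or.inr h

end Levels

section PowerWord

/-- Letters of `v^{N}` as a flattened list: position `n L + s` carries `v s`. [folklore] -/
theorem get_flatten_replicate_ofFn {β : Type*} {n : ℕ} (v : Fin n → β) (N L s : ℕ)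
    (hs : s < n) (h : n * L + s < (List.replicate N (List.ofFn v)).flatten.length) :
    (List.replicate N (List.ofFn v)).flatten.get ⟨n * L + s, h⟩ = v ⟨s, hs⟩ := by
  rw [get_flatten_replicate (List.ofFn v) N (n * L + s) h]
  simp only [List.get_eq_getElem, List.getElem_ofFn, List.length_ofFn]
  congr 1
  simp only [Fin.mk.injEq]
  rw [Nat.mul_add_mod]
  exact Nat.mod_eq_of_lt hs

end PowerWord

section Assembly

open Equiv

/-- **Assembling tripods (CW §4.3, letter level).** Let `v` be a word of length `n` in the
commutator subgroup, and let `cor : Fin T → Fin 3 → ℕ` be `T` tripod copies of prong length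
`ℓ + 1` in `v`: all corners lie in `[ℓ+1, n−ℓ−1]` and for every prong `i` the outgoing side
`v[c_{i+2}, c_{i+2}+ℓ]` read backwards is the inverse of the incoming side `v[cᵢ−ℓ−1, cᵢ−1]`.
Let `g` be a partial gluing of the prongs: a fixed-point-free partial involution such that glued
prongs exchange their incoming and outgoing sides. If every position of `v` lies in at most `N'`
prong sides (incoming sides of all prongs and outgoing sides of unglued prongs), then
`4 cl(v^{N'}) + ℓ (3T + U) + 2T ≤ N' n + 2`, `U` the number of unglued prongs.
[cite: CalegariWalker2013, §4.3 (proof of Prop. 4.2)] -/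
theorem four_mul_cl_pow_le_of_tripods {α : Type*} [DecidableEq α] {n ℓ : ℕ}
    (v : Fin n → α × Bool) (hv : FreeGroup.mk (List.ofFn v) ∈ commutator (FreeGroup α))
    (T : ℕ) (cor : Fin T → Fin 3 → ℕ) (hlo : ∀ r i, ℓ + 1 ≤ cor r i)
    (hhi : ∀ r i, cor r i + (ℓ + 1) ≤ n)
    (hwin : ∀ r (i : Fin 3) (q : Fin (ℓ + 1)),
      v ⟨cor r (i + 2) + (ℓ - q), by have := hhi r (i + 2); omega⟩ =
        ((v ⟨cor r i - (ℓ + 1) + q, by have := hhi r i; omega⟩).1,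
          !(v ⟨cor r i - (ℓ + 1) + q, by have := hhi r i; omega⟩).2))
    (g : Fin T × Fin 3 → Option (Fin T × Fin 3))
    (hgsymm : ∀ p p', g p = some p' → g p' = some p) (hgne : ∀ p, g p ≠ some p)
    (hgsite : ∀ p p', g p = some p' →
      cor p.1 p.2 = cor p'.1 (p'.2 + 2) + (ℓ + 1) ∧ cor p'.1 p'.2 = cor p.1 (p.2 + 2) + (ℓ + 1))
    (N' : ℕ)
    (hcov : ∀ x : ℕ,
      (Finset.univ.filter fun p : Fin T × Fin 3 =>
          cor p.1 p.2 - (ℓ + 1) ≤ x ∧ x < cor p.1 p.2).card +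
        (Finset.univ.filter fun p : Fin T × Fin 3 => g p = none ∧
          cor p.1 (p.2 + 2) ≤ x ∧ x < cor p.1 (p.2 + 2) + (ℓ + 1)).card ≤ N') :
    4 * commutatorLength (FreeGroup.mk (List.ofFn v) ^ N') +
        ℓ * (3 * T + (Finset.univ.filter fun p : Fin T × Fin 3 => g p = none).card) + 2 * T ≤
      N' * n + 2 := by
  classical
  -- ### representatives of the edges (prongs modulo gluing)
  let idx : Fin T × Fin 3 → ℕ := fun p => 3 * (p.1 : ℕ) + (p.2 : ℕ)
  have hidx : Function.Injective idx := by
    rintro ⟨r, i⟩ ⟨r', i'⟩ h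
    simp only [idx] at h
    have h1 : (r : ℕ) = r' := by omega
    have h2 : (i : ℕ) = i' := by omega
    exact Prod.ext (Fin.ext h1) (Fin.ext h2)
  let isRep : Fin T × Fin 3 → Prop := fun p => g p = none ∨ ∃ p', g p = some p' ∧ idx p < idx p'
  set Rep : Finset (Fin T × Fin 3) := Finset.univ.filter fun p => isRep p with hRep
  have hmemRep : ∀ p, p ∈ Rep ↔ isRep p := fun p => by simp [hRep]
  let partner : Fin T × Fin 3 → Fin T × Fin 3 := fun p => (g p).getD p
  have hpartner : ∀ p p', g p = some p' → partner p = p' := by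
    intro p p' h
    simp [partner, h]
  -- a non-representative is glued, and its partner is a representative
  have hnonrep : ∀ p, p ∉ Rep → g p = some (partner p) ∧ partner p ∈ Rep := by
    intro p hp
    rw [hmemRep] at hp
    simp only [isRep, not_or, not_exists, not_and, not_lt] at hp
    obtain ⟨hnone, hall⟩ := hp
    obtain ⟨p', hp'⟩ := Option.ne_none_iff_exists'.mp hnone
    have hpp : partner p = p' := hpartner p p' hp'
    rw [hpp]
    refine ⟨hp', ?_⟩
    rw [hmemRep]
    refine Or.inr ⟨p, hgsymm p p' hp', ?_⟩
    have hle := hall p' hp'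
    have hne : p' ≠ p := fun e => hgne p (e ▸ hp')
    have hne' : idx p' ≠ idx p := fun e => hne (hidx e)
    omega
  -- a representative glued to `p'`: then `p'` is not a representative and its partner is `p`
  have hrep_glued : ∀ p p', p ∈ Rep → g p = some p' → p' ∉ Rep ∧ partner p' = p := by
    intro p p' hp hgp
    have hsymm := hgsymm p p' hgp
    refine ⟨?_, hpartner p' p hsymm⟩
    intro hp'
    rw [hmemRep] at hp hp'
    rcases hp with h | ⟨q, hq, hlt⟩
    · rw [h] at hgp; exact (Option.some_ne_none _ hgp.symm).elim
    rw [hgp] at hq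
    cases hq
    rcases hp' with h' | ⟨q', hq', hlt'⟩
    · rw [h'] at hsymm; exact (Option.some_ne_none _ hsymm.symm).elim
    rw [hsymm] at hq'
    cases hq'
    omega
  -- the representative of a prong and the side flag of its incoming side
  let Edge := {p // p ∈ Rep}
  let repOf : Fin T × Fin 3 → Edge := fun p =>
    if h : p ∈ Rep then ⟨p, h⟩ else ⟨partner p, (hnonrep p h).2⟩
  let inB : Fin T × Fin 3 → Bool := fun p => if p ∈ Rep then false else true
  let inSide : Fin T × Fin 3 → Edge × Bool := fun p => (repOf p, inB p)
  let outSide : Fin T × Fin 3 → Edge × Bool := fun p => (repOf p, !inB p)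
  -- sides as intervals of positions
  let start : Edge × Bool → ℕ := fun σ =>
    if σ.2 then cor σ.1.val.1 (σ.1.val.2 + 2) else cor σ.1.val.1 σ.1.val.2 - (ℓ + 1)
  have hstart_in : ∀ p, start (inSide p) = cor p.1 p.2 - (ℓ + 1) := by
    intro p
    by_cases hp : p ∈ Rep
    · simp [start, inSide, repOf, inB, hp]
    · simp only [start, inSide, repOf, inB, dif_neg hp, if_neg hp, if_true]
      have h := (hgsite p (partner p) (hnonrep p hp).1).1
      omega
  have hstart_out : ∀ p, start (outSide p) = cor p.1 (p.2 + 2) := by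
    intro p
    by_cases hp : p ∈ Rep
    · simp [start, outSide, repOf, inB, hp]
    · simp only [start, outSide, repOf, inB, dif_neg hp, if_neg hp, Bool.not_true]
      have h := (hgsite p (partner p) (hnonrep p hp).1).2
      simp only [Bool.false_eq_true, ↓reduceIte]
      omega
  have hstart_in' : ∀ r i, start (inSide (r, i)) = cor r i - (ℓ + 1) := fun r i => hstart_in (r, i)
  have hstart_out' : ∀ r i, start (outSide (r, i)) = cor r (i + 2) := fun r i => hstart_out (r, i)
  have hflip : ∀ p, ((inSide p).1, !(inSide p).2) = outSide p := fun p => rfl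
  have hin_inj : Function.Injective inSide := by
    intro p p₂ h
    simp only [inSide, Prod.mk.injEq] at h
    obtain ⟨h1, h2⟩ := h
    by_cases hp : p ∈ Rep
    · by_cases hp₂ : p₂ ∈ Rep
      · simp only [repOf, dif_pos hp, dif_pos hp₂] at h1
        exact congrArg Subtype.val h1
      · simp [inB, hp, hp₂] at h2
    · by_cases hp₂ : p₂ ∈ Rep
      · simp [inB, hp, hp₂] at h2
      · simp only [repOf, dif_neg hp, dif_neg hp₂] at h1
        have h1' : partner p = partner p₂ := congrArg Subtype.val h1
        have e1 := hgsymm p (partner p) (hnonrep p hp).1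
        have e2 := hgsymm p₂ (partner p₂) (hnonrep p₂ hp₂).1
        rw [h1'] at e1
        rw [e1] at e2
        exact Option.some.inj e2
  have hout_inj : Function.Injective outSide := by
    intro p p₂ h
    apply hin_inj
    simp only [outSide, Prod.mk.injEq, Bool.not_inj_iff] at h
    simp only [inSide, Prod.mk.injEq]
    exact h
  -- every side is an incoming side, or the outgoing side of an unglued prong
  have hsides : ∀ σ : Edge × Bool, (∃ p, inSide p = σ) ∨ ∃ p, g p = none ∧ outSide p = σ := by
    rintro ⟨⟨p₀, h₀⟩, b⟩
    cases b
    · left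
      refine ⟨p₀, ?_⟩
      simp [inSide, repOf, inB, h₀]
    · rcases hg : g p₀ with _ | p₁
      · right
        refine ⟨p₀, hg, ?_⟩
        simp [outSide, repOf, inB, h₀]
      · left
        obtain ⟨hp₁, hpart⟩ := hrep_glued p₀ p₁ h₀ hg
        refine ⟨p₁, ?_⟩
        simp only [inSide, repOf, dif_neg hp₁, inB, if_neg hp₁, Prod.mk.injEq, and_true]
        exact Subtype.ext hpart
  -- ### the prescribed successor: after the incoming side of prong `i`, the outgoing side of `i+1`
  let succ : Edge × Bool → Option (Edge × Bool) := fun σ =>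
    if h : ∃ p, inSide p = σ then some (outSide (h.choose.1, h.choose.2 + 1)) else none
  have hsucc_in : ∀ r i, succ (inSide (r, i)) = some (outSide (r, i + 1)) := by
    intro r i
    have h : ∃ p', inSide p' = inSide (r, i) := ⟨(r, i), rfl⟩
    simp only [succ, dif_pos h]
    have e : h.choose = (r, i) := hin_inj h.choose_spec
    rw [e]
  have hsucc_some : ∀ σ τ, succ σ = some τ → ∃ r i, inSide (r, i) = σ ∧ τ = outSide (r, i + 1) := by
    intro σ τ h
    by_cases hex : ∃ p, inSide p = σ
    · obtain ⟨⟨r, i⟩, rfl⟩ := hex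
      rw [hsucc_in] at h
      exact ⟨r, i, rfl, (Option.some.inj h).symm⟩
    · simp only [succ, dif_neg hex] at h
      exact (Option.some_ne_none _ h.symm).elim
  -- ### levels
  have hlen1 : ∀ _σ : Edge × Bool, 0 < ℓ + 1 := fun _ => Nat.succ_pos ℓ
  obtain ⟨level, hlev1, hlev2⟩ := exists_levels start (fun _ => ℓ + 1) hlen1 succ
    (by
      intro σ σ' τ h h'
      obtain ⟨r, i, rfl, hτ⟩ := hsucc_some σ τ h
      obtain ⟨r', i', rfl, hτ'⟩ := hsucc_some σ' τ h'
      rw [hτ] at hτ'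
      have e := hout_inj hτ'
      simp only [Prod.mk.injEq, add_left_inj] at e
      rw [e.1, e.2])
    (by
      intro σ τ h
      obtain ⟨r, i, rfl, rfl⟩ := hsucc_some σ τ h
      rw [hstart_out', hstart_in']
      have e : i + 1 + 2 = i := by
        rw [add_assoc]; exact add_eq_left.mpr (by decide)
      rw [e]
      have := hlo r i
      omega)
    N'
    (by
      intro x
      refine le_trans ?_ (hcov x)
      set A := Finset.univ.filter fun p : Fin T × Fin 3 =>
        cor p.1 p.2 - (ℓ + 1) ≤ x ∧ x < cor p.1 p.2 with hA
      set B := Finset.univ.filter fun p : Fin T × Fin 3 => g p = none ∧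
        cor p.1 (p.2 + 2) ≤ x ∧ x < cor p.1 (p.2 + 2) + (ℓ + 1) with hB
      have hsub : (Finset.univ.filter fun σ : Edge × Bool =>
          start σ ≤ x ∧ x < start σ + (ℓ + 1)) ⊆ A.image inSide ∪ B.image outSide := by
        intro σ hσ
        rw [Finset.mem_filter] at hσ
        obtain ⟨-, h1, h2⟩ := hσ
        rw [Finset.mem_union, Finset.mem_image, Finset.mem_image]
        rcases hsides σ with ⟨p, rfl⟩ | ⟨p, hgp, rfl⟩
        · left
          refine ⟨p, ?_, rfl⟩
          rw [hA, Finset.mem_filter]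
          rw [hstart_in] at h1 h2
          have := hlo p.1 p.2
          exact ⟨Finset.mem_univ _, h1, by omega⟩
        · right
          refine ⟨p, ?_, rfl⟩
          rw [hB, Finset.mem_filter]
          rw [hstart_out] at h1 h2
          exact ⟨Finset.mem_univ _, hgp, h1, h2⟩
      calc (Finset.univ.filter fun σ : Edge × Bool => start σ ≤ x ∧ x < start σ + (ℓ + 1)).card
          ≤ (A.image inSide ∪ B.image outSide).card := Finset.card_le_card hsub
        _ ≤ (A.image inSide).card + (B.image outSide).card := Finset.card_union_le _ _
        _ ≤ A.card + B.card := Nat.add_le_add Finset.card_image_le Finset.card_image_le)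
  -- ### the word `W = v^{N'}` and the positions of the sides in it
  set W := (List.replicate N' (List.ofFn v)).flatten with hWdef
  have hWlen : W.length = N' * n := by
    rw [hWdef, length_flatten_replicate, List.length_ofFn]
  have hWmk : FreeGroup.mk W = FreeGroup.mk (List.ofFn v) ^ N' := mk_flatten_replicate _ _
  have hWcomm : FreeGroup.mk W ∈ commutator (FreeGroup α) := by
    rw [hWmk]; exact Subgroup.pow_mem _ hv _
  -- bounds on the sides
  have hstart_lt : ∀ σ : Edge × Bool, start σ + (ℓ + 1) ≤ n := by
    rintro ⟨⟨⟨r, i⟩, hr⟩, b⟩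
    cases b
    · simp only [start, Bool.false_eq_true, ↓reduceIte]
      have := hhi r i; have := hlo r i; omega
    · simp only [start, ↓reduceIte]
      exact hhi r (i + 2)
  let pos : Edge × Bool → ℕ → ℕ := fun σ q => n * (level σ : ℕ) + (start σ + q)
  have hpos_lt : ∀ σ q, q < ℓ + 1 → pos σ q < W.length := by
    intro σ q hq
    have h1 := hstart_lt σ
    have h2 : (level σ : ℕ) + 1 ≤ N' := (level σ).isLt
    rw [hWlen]
    calc pos σ q < n * (level σ : ℕ) + n := by simp only [pos]; omega
      _ = n * ((level σ : ℕ) + 1) := by ring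
      _ ≤ n * N' := Nat.mul_le_mul_left _ h2
      _ = N' * n := Nat.mul_comm _ _
  -- letters at these positions
  have hget : ∀ σ q (hq : q < ℓ + 1), W.get ⟨pos σ q, hpos_lt σ q hq⟩ =
      v ⟨start σ + q, by have := hstart_lt σ; omega⟩ := by
    intro σ q hq
    exact get_flatten_replicate_ofFn v N' (level σ : ℕ) (start σ + q) _ _
  -- ### the data for `commutatorLength_le_of_tripodSystem`
  set M := Rep.card with hM
  let eM : Fin M ≃ Edge := Rep.equivFin.symm
  let P : Fin M × Fin (ℓ + 1) × Bool → Fin W.length := fun t =>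
    ⟨pos (eM t.1, t.2.2) t.2.1, hpos_lt _ _ t.2.1.isLt⟩
  have hPval : ∀ m q b, ((P (m, q, b) : Fin W.length) : ℕ) = pos (eM m, b) q := fun _ _ _ => rfl
  have hn_of_side : ∀ _σ : Edge × Bool, 0 < n := by
    intro σ
    have := hstart_lt σ; omega
  have hP : Function.Injective P := by
    rintro ⟨m, q, b⟩ ⟨m', q', b'⟩ h
    have hval : pos (eM m, b) q = pos (eM m', b') q' := by
      rw [← hPval, ← hPval, h]
    have hn := hn_of_side (eM m, b)
    have hs : start (eM m, b) + q < n := by have := hstart_lt (eM m, b); omega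
    have hs' : start (eM m', b') + q' < n := by have := hstart_lt (eM m', b'); omega
    have hl : (level (eM m, b) : ℕ) = level (eM m', b') := by
      have e1 : pos (eM m, b) q / n = level (eM m, b) := by
        simp only [pos]; rw [Nat.mul_add_div hn, Nat.div_eq_of_lt hs, add_zero]
      have e2 : pos (eM m', b') q' / n = level (eM m', b') := by
        simp only [pos]; rw [Nat.mul_add_div hn, Nat.div_eq_of_lt hs', add_zero]
      rw [← e1, ← e2, hval]
    have hsq : start (eM m, b) + q = start (eM m', b') + q' := by
      have e1 : pos (eM m, b) q % n = start (eM m, b) + q := by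
        simp only [pos]; rw [Nat.mul_add_mod, Nat.mod_eq_of_lt hs]
      have e2 : pos (eM m', b') q' % n = start (eM m', b') + q' := by
        simp only [pos]; rw [Nat.mul_add_mod, Nat.mod_eq_of_lt hs']
      rw [← e1, ← e2, hval]
    by_cases hσ : (eM m, b) = (eM m', b')
    · simp only [Prod.mk.injEq] at hσ
      obtain ⟨h1, h2⟩ := hσ
      have hm : m = m' := eM.injective h1
      subst hm; subst h2
      have hq : q = q' := Fin.ext (by omega)
      subst hq
      rfl
    · exfalso
      have hdis := hlev1 _ _ hσ (Fin.ext hl)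
      have hq1 := q.isLt
      have hq2 := q'.isLt
      omega
  have hPq : ∀ r q b, ((P (r, q, b) : Fin W.length) : ℕ) = (P (r, 0, b) : ℕ) + q := by
    intro r q b
    rw [hPval, hPval]
    simp only [pos, Fin.val_zero]
    ring
  have hinv : ∀ r (q : Fin (ℓ + 1)), W.get (P (r, ⟨ℓ - q, by omega⟩, true)) =
      ((W.get (P (r, q, false))).1, !(W.get (P (r, q, false))).2) := by
    intro m q
    have e1 : W.get (P (m, ⟨ℓ - q, by omega⟩, true)) =
        v ⟨start (eM m, true) + (ℓ - q), by have := hstart_lt (eM m, true); omega⟩ :=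
      hget (eM m, true) (ℓ - q) (by omega)
    have e2 : W.get (P (m, q, false)) =
        v ⟨start (eM m, false) + q, by have := hstart_lt (eM m, false); omega⟩ :=
      hget (eM m, false) q q.isLt
    rw [e1, e2]
    have key : ∀ (E : Edge) (h1 : start (E, true) + (ℓ - q) < n) (h2 : start (E, false) + q < n),
        v ⟨start (E, true) + (ℓ - q), h1⟩ =
          ((v ⟨start (E, false) + q, h2⟩).1, !(v ⟨start (E, false) + q, h2⟩).2) := by
      rintro ⟨⟨r, i⟩, hr⟩ h1 h2
      exact hwin r i q
    exact key (eM m) _ _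
  -- the tripod corners
  let C : Fin T × Fin 3 → Fin M × Bool := fun p => (eM.symm (inSide p).1, (inSide p).2)
  have hC : Function.Injective C := by
    intro p p' h
    simp only [C, Prod.mk.injEq, EmbeddingLike.apply_eq_iff_eq] at h
    exact hin_inj (Prod.ext h.1 h.2)
  have hadj : ∀ r (i : Fin 3),
      ((P ((C (r, i)).1, ⟨ℓ, by omega⟩, (C (r, i)).2) : Fin W.length) : ℕ) + 1 =
        (P ((C (r, i + 1)).1, 0, !(C (r, i + 1)).2) : ℕ) := by
    intro r i
    rw [hPval, hPval]
    simp only [C, Equiv.apply_symm_apply]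
    have e1 : ((inSide (r, i)).1, (inSide (r, i)).2) = inSide (r, i) := rfl
    have e2 : ((inSide (r, i + 1)).1, !(inSide (r, i + 1)).2) = outSide (r, i + 1) := hflip _
    rw [e1, e2]
    have hl : level (inSide (r, i)) = level (outSide (r, i + 1)) :=
      hlev2 _ _ (hsucc_in r i)
    simp only [pos, Fin.val_zero, add_zero]
    rw [hl, hstart_in', hstart_out']
    have e : i + 1 + 2 = i := by
      rw [add_assoc]; exact add_eq_left.mpr (by decide)
    rw [e]
    have := hlo r i
    omega
  -- ### the bound
  have hmain := commutatorLength_le_of_tripodSystem W hWcomm ℓ M P hP hPq hinv T C hC hadj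
  -- `2 M = 3 T + U`
  set Ung := Finset.univ.filter fun p : Fin T × Fin 3 => g p = none with hUng
  have hcardM : 2 * M = 3 * T + Ung.card := by
    set GRep := Finset.univ.filter fun p : Fin T × Fin 3 =>
      ∃ p', g p = some p' ∧ idx p < idx p' with hGRep
    set GNon := Finset.univ.filter fun p : Fin T × Fin 3 => p ∉ Rep with hGNon
    have hRepU : Rep = Ung ∪ GRep := by
      ext p
      rw [hmemRep, Finset.mem_union, hUng, hGRep, Finset.mem_filter, Finset.mem_filter]
      simp [isRep]
    have hdisj : Disjoint Ung GRep := by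
      rw [Finset.disjoint_left]
      intro p hp hp'
      rw [hUng, Finset.mem_filter] at hp
      rw [hGRep, Finset.mem_filter] at hp'
      obtain ⟨p', hp', -⟩ := hp'.2
      rw [hp.2] at hp'
      exact (Option.some_ne_none _ hp'.symm).elim
    have hM' : M = Ung.card + GRep.card := by
      rw [hM, hRepU, Finset.card_union_of_disjoint hdisj]
    -- the non-representatives are in bijection with the glued representatives
    have hbij : GNon.card = GRep.card := by
      refine Finset.card_bij (fun p _ => partner p) ?_ ?_ ?_
      · intro p hp
        rw [hGNon, Finset.mem_filter] at hp
        obtain ⟨hg, hpr⟩ := hnonrep p hp.2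
        rw [hGRep, Finset.mem_filter]
        have hpr' := (hmemRep _).mp hpr
        rcases hpr' with h | h
        · rw [hgsymm p _ hg] at h; exact absurd h (by simp)
        · exact ⟨Finset.mem_univ _, h⟩
      · intro p hp p₂ hp₂ h
        rw [hGNon, Finset.mem_filter] at hp hp₂
        have e1 := hgsymm p _ (hnonrep p hp.2).1
        have e2 := hgsymm p₂ _ (hnonrep p₂ hp₂.2).1
        rw [h] at e1
        rw [e1] at e2
        exact Option.some.inj e2
      · intro p' hp'
        rw [hGRep, Finset.mem_filter] at hp'
        obtain ⟨-, p, hgp, hlt⟩ := hp'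
        have hp'Rep : p' ∈ Rep := (hmemRep p').mpr (Or.inr ⟨p, hgp, hlt⟩)
        obtain ⟨hpn, hpart⟩ := hrep_glued p' p hp'Rep hgp
        refine ⟨p, ?_, hpart⟩
        rw [hGNon, Finset.mem_filter]
        exact ⟨Finset.mem_univ _, hpn⟩
    have htot : Rep.card + GNon.card = 3 * T := by
      have h := Finset.card_filter_add_card_filter_not
        (s := (Finset.univ : Finset (Fin T × Fin 3))) (fun p => isRep p)
      rw [Finset.card_univ, Fintype.card_prod, Fintype.card_fin, Fintype.card_fin] at h
      have e : (Finset.univ.filter fun p : Fin T × Fin 3 => ¬ isRep p) = GNon := by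
        rw [hGNon]
        ext p
        simp only [Finset.mem_filter, Finset.mem_univ, true_and, hmemRep]
      rw [← hRep, e] at h
      omega
    omega
  rw [hWlen, hWmk] at hmain
  have e : 2 * ℓ * M = ℓ * (2 * M) := by ring
  rw [e, hcardM] at hmain
  exact hmain

end Assembly

section GluedAssembly

open Equiv

/-- **Assembling the glued tripods only (CW §4.3, letter level).** Same data as in
`four_mul_cl_pow_le_of_tripods`, but now only the glued prongs are realised as edges of the
fatgraph (an unglued prong contributes no side, and its tripod is not credited), so that the
coverage hypothesis only involves the incoming sides: if every position of `v` lies in at most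
`N'` incoming prong sides then `4 cl(v^{N'}) + ℓ (3T − U) + 2T ≤ N' n + 2 + 2U`, `U` the number
of unglued prongs (the `(3T − U)/2` glued edges give `ℓ` two-cycles each, and at least `T − U`
tripods keep all three corners). [cite: CalegariWalker2013, §4.3 (proof of Prop. 4.2)] -/
theorem four_mul_cl_pow_le_of_gluedTripods {α : Type*} [DecidableEq α] {n ℓ : ℕ}
    (v : Fin n → α × Bool) (hv : FreeGroup.mk (List.ofFn v) ∈ commutator (FreeGroup α))
    (T : ℕ) (cor : Fin T → Fin 3 → ℕ) (hlo : ∀ r i, ℓ + 1 ≤ cor r i)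
    (hhi : ∀ r i, cor r i + (ℓ + 1) ≤ n)
    (hwin : ∀ r (i : Fin 3) (q : Fin (ℓ + 1)),
      v ⟨cor r (i + 2) + (ℓ - q), by have := hhi r (i + 2); omega⟩ =
        ((v ⟨cor r i - (ℓ + 1) + q, by have := hhi r i; omega⟩).1,
          !(v ⟨cor r i - (ℓ + 1) + q, by have := hhi r i; omega⟩).2))
    (g : Fin T × Fin 3 → Option (Fin T × Fin 3))
    (hgsymm : ∀ p p', g p = some p' → g p' = some p) (hgne : ∀ p, g p ≠ some p)
    (hgsite : ∀ p p', g p = some p' →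
      cor p.1 p.2 = cor p'.1 (p'.2 + 2) + (ℓ + 1) ∧ cor p'.1 p'.2 = cor p.1 (p.2 + 2) + (ℓ + 1))
    (N' : ℕ)
    (hcov : ∀ x : ℕ,
      (Finset.univ.filter fun p : Fin T × Fin 3 =>
          cor p.1 p.2 - (ℓ + 1) ≤ x ∧ x < cor p.1 p.2).card ≤ N') :
    4 * commutatorLength (FreeGroup.mk (List.ofFn v) ^ N') +
        ℓ * (3 * T - (Finset.univ.filter fun p : Fin T × Fin 3 => g p = none).card) + 2 * T ≤
      N' * n + 2 + 2 * (Finset.univ.filter fun p : Fin T × Fin 3 => g p = none).card := by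
  classical
  -- ### representatives of the glued edges
  let idx : Fin T × Fin 3 → ℕ := fun p => 3 * (p.1 : ℕ) + (p.2 : ℕ)
  have hidx : Function.Injective idx := by
    rintro ⟨r, i⟩ ⟨r', i'⟩ h
    simp only [idx] at h
    have h1 : (r : ℕ) = r' := by omega
    have h2 : (i : ℕ) = i' := by omega
    exact Prod.ext (Fin.ext h1) (Fin.ext h2)
  let isRep : Fin T × Fin 3 → Prop := fun p => ∃ p', g p = some p' ∧ idx p < idx p'
  set Rep : Finset (Fin T × Fin 3) := Finset.univ.filter fun p => isRep p with hRep
  have hmemRep : ∀ p, p ∈ Rep ↔ isRep p := fun p => by simp [hRep]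
  let partner : Fin T × Fin 3 → Fin T × Fin 3 := fun p => (g p).getD p
  have hpartner : ∀ p p', g p = some p' → partner p = p' := by
    intro p p' h
    simp [partner, h]
  have hglued_partner : ∀ p, g p ≠ none → g p = some (partner p) := by
    intro p hp
    obtain ⟨p', hp'⟩ := Option.ne_none_iff_exists'.mp hp
    rw [hpartner p p' hp']
    exact hp'
  -- a glued non-representative: its partner is a representative
  have hnonrep : ∀ p, g p ≠ none → p ∉ Rep → partner p ∈ Rep := by
    intro p hg hp
    have hgp := hglued_partner p hg
    rw [hmemRep]
    refine ⟨p, hgsymm p _ hgp, ?_⟩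
    rw [hmemRep] at hp
    simp only [isRep, not_exists, not_and, not_lt] at hp
    have hle := hp (partner p) hgp
    have hne : partner p ≠ p := fun e => hgne p (by rw [e] at hgp; exact hgp)
    have hne' : idx (partner p) ≠ idx p := fun e => hne (hidx e)
    omega
  -- a representative: it is glued, its partner is not a representative, partner² = id
  have hrep : ∀ p, p ∈ Rep → g p ≠ none ∧ partner p ∉ Rep ∧ partner (partner p) = p := by
    intro p hp
    have hp' := (hmemRep p).mp hp
    obtain ⟨q, hq, hlt⟩ := hp'
    have hpq : partner p = q := hpartner p q hq
    rw [hpq]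
    have hsymm := hgsymm p q hq
    refine ⟨by rw [hq]; exact Option.some_ne_none _, ?_, hpartner q p hsymm⟩
    intro hqRep
    obtain ⟨q', hq', hlt'⟩ := (hmemRep q).mp hqRep
    rw [hsymm] at hq'
    cases hq'
    omega
  let Edge := {p // p ∈ Rep}
  let GP := {p : Fin T × Fin 3 // g p ≠ none}
  let repOf : GP → Edge := fun q =>
    if h : q.1 ∈ Rep then ⟨q.1, h⟩ else ⟨partner q.1, hnonrep q.1 q.2 h⟩
  let inB : GP → Bool := fun q => if q.1 ∈ Rep then false else true
  let inSide : GP → Edge × Bool := fun q => (repOf q, inB q)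
  let outSide : GP → Edge × Bool := fun q => (repOf q, !inB q)
  let start : Edge × Bool → ℕ := fun σ =>
    if σ.2 then cor σ.1.val.1 (σ.1.val.2 + 2) else cor σ.1.val.1 σ.1.val.2 - (ℓ + 1)
  have hstart_in : ∀ q : GP, start (inSide q) = cor q.1.1 q.1.2 - (ℓ + 1) := by
    intro q
    by_cases hp : q.1 ∈ Rep
    · simp [start, inSide, repOf, inB, hp]
    · simp only [start, inSide, repOf, inB, dif_neg hp, if_neg hp, if_true]
      have h := (hgsite q.1 (partner q.1) (hglued_partner q.1 q.2)).1
      omega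
  have hstart_out : ∀ q : GP, start (outSide q) = cor q.1.1 (q.1.2 + 2) := by
    intro q
    by_cases hp : q.1 ∈ Rep
    · simp [start, outSide, repOf, inB, hp]
    · simp only [start, outSide, repOf, inB, dif_neg hp, if_neg hp, Bool.not_true]
      have h := (hgsite q.1 (partner q.1) (hglued_partner q.1 q.2)).2
      simp only [Bool.false_eq_true, ↓reduceIte]
      omega
  have hflip : ∀ q, ((inSide q).1, !(inSide q).2) = outSide q := fun q => rfl
  have hin_inj : Function.Injective inSide := by
    rintro ⟨p, hgp⟩ ⟨p₂, hgp₂⟩ h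
    simp only [inSide, Prod.mk.injEq] at h
    obtain ⟨h1, h2⟩ := h
    have key : p = p₂ := by
      by_cases hp : p ∈ Rep
      · by_cases hp₂ : p₂ ∈ Rep
        · simp only [repOf, dif_pos hp, dif_pos hp₂] at h1
          exact congrArg Subtype.val h1
        · simp [inB, hp, hp₂] at h2
      · by_cases hp₂ : p₂ ∈ Rep
        · simp [inB, hp, hp₂] at h2
        · simp only [repOf, dif_neg hp, dif_neg hp₂] at h1
          have h1' : partner p = partner p₂ := congrArg Subtype.val h1
          have e1 := hgsymm p (partner p) (hglued_partner p hgp)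
          have e2 := hgsymm p₂ (partner p₂) (hglued_partner p₂ hgp₂)
          rw [h1'] at e1
          rw [e1] at e2
          exact Option.some.inj e2
    subst key
    rfl
  have hout_inj : Function.Injective outSide := by
    intro q q₂ h
    apply hin_inj
    simp only [outSide, Prod.mk.injEq, Bool.not_inj_iff] at h
    simp only [inSide, Prod.mk.injEq]
    exact h
  -- every side is the incoming side of a glued prong
  have hsides : ∀ σ : Edge × Bool, ∃ q, inSide q = σ := by
    rintro ⟨⟨p₀, h₀⟩, b⟩
    obtain ⟨hg₀, hpn, hpp⟩ := hrep p₀ h₀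
    cases b
    · refine ⟨⟨p₀, hg₀⟩, ?_⟩
      simp [inSide, repOf, inB, h₀]
    · have hg₁ : g (partner p₀) ≠ none := by
        rw [hgsymm p₀ _ (hglued_partner p₀ hg₀)]; exact Option.some_ne_none _
      refine ⟨⟨partner p₀, hg₁⟩, ?_⟩
      simp only [inSide, repOf, dif_neg hpn, inB, if_neg hpn, Prod.mk.injEq, and_true]
      exact Subtype.ext hpp
  -- ### the prescribed successor (only when the next prong is glued as well)
  let succ : Edge × Bool → Option (Edge × Bool) := fun σ =>
    if h : ∃ q : GP, inSide q = σ ∧ g (q.1.1, q.1.2 + 1) ≠ none then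
      some (outSide ⟨(h.choose.1.1, h.choose.1.2 + 1), h.choose_spec.2⟩) else none
  have hsucc_in : ∀ (r : Fin T) (i : Fin 3) (hg : g (r, i) ≠ none) (hg' : g (r, i + 1) ≠ none),
      succ (inSide ⟨(r, i), hg⟩) = some (outSide ⟨(r, i + 1), hg'⟩) := by
    intro r i hg hg'
    have h : ∃ q : GP, inSide q = inSide ⟨(r, i), hg⟩ ∧ g (q.1.1, q.1.2 + 1) ≠ none :=
      ⟨⟨(r, i), hg⟩, rfl, hg'⟩
    simp only [succ, dif_pos h]
    have e : h.choose = ⟨(r, i), hg⟩ := hin_inj h.choose_spec.1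
    congr 1
    congr 1
    apply Subtype.ext
    show (h.choose.1.1, h.choose.1.2 + 1) = (r, i + 1)
    rw [e]
  have hsucc_some : ∀ σ τ, succ σ = some τ → ∃ (r : Fin T) (i : Fin 3) (hg : g (r, i) ≠ none)
      (hg' : g (r, i + 1) ≠ none), inSide ⟨(r, i), hg⟩ = σ ∧ τ = outSide ⟨(r, i + 1), hg'⟩ := by
    intro σ τ h
    by_cases hex : ∃ q : GP, inSide q = σ ∧ g (q.1.1, q.1.2 + 1) ≠ none
    · obtain ⟨⟨⟨r, i⟩, hg⟩, rfl, hg'⟩ := hex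
      rw [hsucc_in r i hg hg'] at h
      exact ⟨r, i, hg, hg', rfl, (Option.some.inj h).symm⟩
    · simp only [succ, dif_neg hex] at h
      exact (Option.some_ne_none _ h.symm).elim
  have hstart_in' : ∀ r i (hg : g (r, i) ≠ none),
      start (inSide ⟨(r, i), hg⟩) = cor r i - (ℓ + 1) := fun r i hg => hstart_in ⟨(r, i), hg⟩
  have hstart_out' : ∀ r i (hg : g (r, i) ≠ none),
      start (outSide ⟨(r, i), hg⟩) = cor r (i + 2) := fun r i hg => hstart_out ⟨(r, i), hg⟩
  -- ### levels
  have hlen1 : ∀ _σ : Edge × Bool, 0 < ℓ + 1 := fun _ => Nat.succ_pos ℓ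
  obtain ⟨level, hlev1, hlev2⟩ := exists_levels start (fun _ => ℓ + 1) hlen1 succ
    (by
      intro σ σ' τ h h'
      obtain ⟨r, i, hg, hg', rfl, hτ⟩ := hsucc_some σ τ h
      obtain ⟨r', i', hgg, hgg', rfl, hτ'⟩ := hsucc_some σ' τ h'
      rw [hτ] at hτ'
      have e := congrArg Subtype.val (hout_inj hτ')
      simp only [Prod.mk.injEq, add_left_inj] at e
      obtain ⟨rfl, rfl⟩ := e
      rfl)
    (by
      intro σ τ h
      obtain ⟨r, i, hg, hg', rfl, rfl⟩ := hsucc_some σ τ h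
      rw [hstart_out', hstart_in']
      have e : i + 1 + 2 = i := by
        rw [add_assoc]; exact add_eq_left.mpr (by decide)
      rw [e]
      have := hlo r i
      omega)
    N'
    (by
      intro x
      refine le_trans ?_ (hcov x)
      set A := Finset.univ.filter fun p : Fin T × Fin 3 =>
        cor p.1 p.2 - (ℓ + 1) ≤ x ∧ x < cor p.1 p.2 with hA
      let f : Edge × Bool → Fin T × Fin 3 := fun σ => ((hsides σ).choose).1
      have hf : ∀ σ, inSide (hsides σ).choose = σ := fun σ => (hsides σ).choose_spec
      refine Finset.card_le_card_of_injOn f ?_ ?_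
      · intro σ hσ
        rw [Finset.mem_coe, Finset.mem_filter] at hσ
        obtain ⟨-, h1, h2⟩ := hσ
        have ef : f σ = ((hsides σ).choose).1 := rfl
        rw [Finset.mem_coe, hA, Finset.mem_filter, ef]
        rw [← hf σ, hstart_in] at h1 h2
        have := hlo ((hsides σ).choose).1.1 ((hsides σ).choose).1.2
        exact ⟨Finset.mem_univ _, h1, by omega⟩
      · intro σ _ σ' _ h
        have e : (hsides σ).choose = (hsides σ').choose := Subtype.ext h
        rw [← hf σ, ← hf σ', e])
  -- ### the word `W = v^{N'}` and the positions of the sides in it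
  set W := (List.replicate N' (List.ofFn v)).flatten with hWdef
  have hWlen : W.length = N' * n := by
    rw [hWdef, length_flatten_replicate, List.length_ofFn]
  have hWmk : FreeGroup.mk W = FreeGroup.mk (List.ofFn v) ^ N' := mk_flatten_replicate _ _
  have hWcomm : FreeGroup.mk W ∈ commutator (FreeGroup α) := by
    rw [hWmk]; exact Subgroup.pow_mem _ hv _
  have hstart_lt : ∀ σ : Edge × Bool, start σ + (ℓ + 1) ≤ n := by
    rintro ⟨⟨⟨r, i⟩, hr⟩, b⟩
    cases b
    · simp only [start, Bool.false_eq_true, ↓reduceIte]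
      have := hhi r i; have := hlo r i; omega
    · simp only [start, ↓reduceIte]
      exact hhi r (i + 2)
  let pos : Edge × Bool → ℕ → ℕ := fun σ q => n * (level σ : ℕ) + (start σ + q)
  have hpos_lt : ∀ σ q, q < ℓ + 1 → pos σ q < W.length := by
    intro σ q hq
    have h1 := hstart_lt σ
    have h2 : (level σ : ℕ) + 1 ≤ N' := (level σ).isLt
    rw [hWlen]
    calc pos σ q < n * (level σ : ℕ) + n := by simp only [pos]; omega
      _ = n * ((level σ : ℕ) + 1) := by ring
      _ ≤ n * N' := Nat.mul_le_mul_left _ h2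
      _ = N' * n := Nat.mul_comm _ _
  have hget : ∀ σ q (hq : q < ℓ + 1), W.get ⟨pos σ q, hpos_lt σ q hq⟩ =
      v ⟨start σ + q, by have := hstart_lt σ; omega⟩ := by
    intro σ q hq
    exact get_flatten_replicate_ofFn v N' (level σ : ℕ) (start σ + q) _ _
  -- ### the data for `commutatorLength_le_of_tripodSystem`
  set M := Rep.card with hM
  let eM : Fin M ≃ Edge := Rep.equivFin.symm
  let P : Fin M × Fin (ℓ + 1) × Bool → Fin W.length := fun t =>
    ⟨pos (eM t.1, t.2.2) t.2.1, hpos_lt _ _ t.2.1.isLt⟩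
  have hPval : ∀ m q b, ((P (m, q, b) : Fin W.length) : ℕ) = pos (eM m, b) q := fun _ _ _ => rfl
  have hn_of_side : ∀ _σ : Edge × Bool, 0 < n := by
    intro σ
    have := hstart_lt σ; omega
  have hP : Function.Injective P := by
    rintro ⟨m, q, b⟩ ⟨m', q', b'⟩ h
    have hval : pos (eM m, b) q = pos (eM m', b') q' := by
      rw [← hPval, ← hPval, h]
    have hn := hn_of_side (eM m, b)
    have hs : start (eM m, b) + q < n := by have := hstart_lt (eM m, b); omega
    have hs' : start (eM m', b') + q' < n := by have := hstart_lt (eM m', b'); omega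
    have hl : (level (eM m, b) : ℕ) = level (eM m', b') := by
      have e1 : pos (eM m, b) q / n = level (eM m, b) := by
        simp only [pos]; rw [Nat.mul_add_div hn, Nat.div_eq_of_lt hs, add_zero]
      have e2 : pos (eM m', b') q' / n = level (eM m', b') := by
        simp only [pos]; rw [Nat.mul_add_div hn, Nat.div_eq_of_lt hs', add_zero]
      rw [← e1, ← e2, hval]
    have hsq : start (eM m, b) + q = start (eM m', b') + q' := by
      have e1 : pos (eM m, b) q % n = start (eM m, b) + q := by
        simp only [pos]; rw [Nat.mul_add_mod, Nat.mod_eq_of_lt hs]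
      have e2 : pos (eM m', b') q' % n = start (eM m', b') + q' := by
        simp only [pos]; rw [Nat.mul_add_mod, Nat.mod_eq_of_lt hs']
      rw [← e1, ← e2, hval]
    by_cases hσ : (eM m, b) = (eM m', b')
    · simp only [Prod.mk.injEq] at hσ
      obtain ⟨h1, h2⟩ := hσ
      have hm : m = m' := eM.injective h1
      subst hm; subst h2
      have hq : q = q' := Fin.ext (by omega)
      subst hq
      rfl
    · exfalso
      have hdis := hlev1 _ _ hσ (Fin.ext hl)
      have hq1 := q.isLt
      have hq2 := q'.isLt
      omega
  have hPq : ∀ r q b, ((P (r, q, b) : Fin W.length) : ℕ) = (P (r, 0, b) : ℕ) + q := by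
    intro r q b
    rw [hPval, hPval]
    simp only [pos, Fin.val_zero]
    ring
  have hinv : ∀ r (q : Fin (ℓ + 1)), W.get (P (r, ⟨ℓ - q, by omega⟩, true)) =
      ((W.get (P (r, q, false))).1, !(W.get (P (r, q, false))).2) := by
    intro m q
    have e1 : W.get (P (m, ⟨ℓ - q, by omega⟩, true)) =
        v ⟨start (eM m, true) + (ℓ - q), by have := hstart_lt (eM m, true); omega⟩ :=
      hget (eM m, true) (ℓ - q) (by omega)
    have e2 : W.get (P (m, q, false)) =
        v ⟨start (eM m, false) + q, by have := hstart_lt (eM m, false); omega⟩ :=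
      hget (eM m, false) q q.isLt
    rw [e1, e2]
    have key : ∀ (E : Edge) (h1 : start (E, true) + (ℓ - q) < n) (h2 : start (E, false) + q < n),
        v ⟨start (E, true) + (ℓ - q), h1⟩ =
          ((v ⟨start (E, false) + q, h2⟩).1, !(v ⟨start (E, false) + q, h2⟩).2) := by
      rintro ⟨⟨r, i⟩, hr⟩ h1 h2
      exact hwin r i q
    exact key (eM m) _ _
  -- the fully glued tripods and their corners
  set FT := Finset.univ.filter fun r : Fin T => ∀ i, g (r, i) ≠ none with hFT
  set t := FT.card with ht
  let eT : Fin t ≃ {r // r ∈ FT} := FT.equivFin.symm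
  have hFTmem : ∀ s : Fin t, ∀ i, g ((eT s : Fin T), i) ≠ none := by
    intro s i
    exact (Finset.mem_filter.mp (eT s).2).2 i
  let C : Fin t × Fin 3 → Fin M × Bool := fun x =>
    (eM.symm (inSide ⟨((eT x.1 : Fin T), x.2), hFTmem x.1 x.2⟩).1,
      (inSide ⟨((eT x.1 : Fin T), x.2), hFTmem x.1 x.2⟩).2)
  have hC : Function.Injective C := by
    rintro ⟨s, i⟩ ⟨s', i'⟩ h
    simp only [C, Prod.mk.injEq, EmbeddingLike.apply_eq_iff_eq] at h
    have e := congrArg Subtype.val (hin_inj (Prod.ext h.1 h.2))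
    simp only [Prod.mk.injEq] at e
    obtain ⟨e1, e2⟩ := e
    have hs : s = s' := eT.injective (Subtype.ext e1)
    rw [hs, e2]
  have hadj : ∀ s (i : Fin 3),
      ((P ((C (s, i)).1, ⟨ℓ, by omega⟩, (C (s, i)).2) : Fin W.length) : ℕ) + 1 =
        (P ((C (s, i + 1)).1, 0, !(C (s, i + 1)).2) : ℕ) := by
    intro s i
    rw [hPval, hPval]
    simp only [C, Equiv.apply_symm_apply]
    set r : Fin T := (eT s : Fin T) with hr
    have hg : g (r, i) ≠ none := hFTmem s i
    have hg' : g (r, i + 1) ≠ none := hFTmem s (i + 1)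
    have e1 : ((inSide ⟨(r, i), hg⟩).1, (inSide ⟨(r, i), hg⟩).2) = inSide ⟨(r, i), hg⟩ := rfl
    have e2 : ((inSide ⟨(r, i + 1), hg'⟩).1, !(inSide ⟨(r, i + 1), hg'⟩).2) =
        outSide ⟨(r, i + 1), hg'⟩ := hflip _
    rw [e1, e2]
    have hl : level (inSide ⟨(r, i), hg⟩) = level (outSide ⟨(r, i + 1), hg'⟩) :=
      hlev2 _ _ (hsucc_in r i hg hg')
    simp only [pos, Fin.val_zero, add_zero]
    rw [hl, hstart_in', hstart_out']
    have e : i + 1 + 2 = i := by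
      rw [add_assoc]; exact add_eq_left.mpr (by decide)
    rw [e]
    have := hlo r i
    omega
  -- ### the bound
  have hmain := commutatorLength_le_of_tripodSystem W hWcomm ℓ M P hP hPq hinv t C hC hadj
  -- `2 M = 3 T − U`
  set Ung := Finset.univ.filter fun p : Fin T × Fin 3 => g p = none with hUng
  have hUng_le : Ung.card ≤ 3 * T := by
    have h := Finset.card_le_univ Ung
    rw [Fintype.card_prod, Fintype.card_fin, Fintype.card_fin] at h
    omega
  have hcardM : 2 * M + Ung.card = 3 * T := by
    set GNon := Finset.univ.filter fun p : Fin T × Fin 3 => g p ≠ none ∧ p ∉ Rep with hGNon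
    -- the glued non-representatives are in bijection with the representatives
    have hbij : GNon.card = Rep.card := by
      refine Finset.card_bij (fun p _ => partner p) ?_ ?_ ?_
      · intro p hp
        rw [hGNon, Finset.mem_filter] at hp
        exact hnonrep p hp.2.1 hp.2.2
      · intro p hp p₂ hp₂ h
        rw [hGNon, Finset.mem_filter] at hp hp₂
        have e1 := hgsymm p _ (hglued_partner p hp.2.1)
        have e2 := hgsymm p₂ _ (hglued_partner p₂ hp₂.2.1)
        rw [h] at e1
        rw [e1] at e2
        exact Option.some.inj e2
      · intro p' hp'
        obtain ⟨hg', hpn, hpp⟩ := hrep p' hp'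
        have hg₁ : g (partner p') ≠ none := by
          rw [hgsymm p' _ (hglued_partner p' hg')]; exact Option.some_ne_none _
        refine ⟨partner p', ?_, hpp⟩
        rw [hGNon, Finset.mem_filter]
        exact ⟨Finset.mem_univ _, hg₁, hpn⟩
    -- everything is unglued, a representative, or a glued non-representative
    have hdisj1 : Disjoint Ung (Rep ∪ GNon) := by
      rw [Finset.disjoint_left]
      intro p hp hp'
      rw [hUng, Finset.mem_filter] at hp
      rw [Finset.mem_union] at hp'
      rcases hp' with h | h
      · exact (hrep p h).1 hp.2
      · rw [hGNon, Finset.mem_filter] at h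
        exact h.2.1 hp.2
    have hdisj2 : Disjoint Rep GNon := by
      rw [Finset.disjoint_left]
      intro p hp hp'
      rw [hGNon, Finset.mem_filter] at hp'
      exact hp'.2.2 hp
    have hunion : Ung ∪ (Rep ∪ GNon) = Finset.univ := by
      ext p
      simp only [Finset.mem_union, Finset.mem_univ, iff_true]
      by_cases hg : g p = none
      · left; rw [hUng, Finset.mem_filter]; exact ⟨Finset.mem_univ _, hg⟩
      · right
        by_cases hr : p ∈ Rep
        · left; exact hr
        · right; rw [hGNon, Finset.mem_filter]; exact ⟨Finset.mem_univ _, hg, hr⟩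
    have hcard := congrArg Finset.card hunion
    rw [Finset.card_union_of_disjoint hdisj1, Finset.card_union_of_disjoint hdisj2,
      Finset.card_univ, Fintype.card_prod, Fintype.card_fin, Fintype.card_fin, hbij] at hcard
    omega
  -- `t ≥ T − U`
  have ht_ge : T ≤ t + Ung.card := by
    have hsplit := Finset.card_filter_add_card_filter_not
      (s := (Finset.univ : Finset (Fin T))) (fun r => ∀ i, g (r, i) ≠ none)
    rw [Finset.card_univ, Fintype.card_fin] at hsplit
    rw [← hFT] at hsplit
    -- the tripods with an unglued prong inject into the unglued prongs
    have hle : (Finset.univ.filter fun r : Fin T => ¬ ∀ i, g (r, i) ≠ none).card ≤ Ung.card := by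
      have key : ∀ r ∈ (Finset.univ.filter fun r : Fin T => ¬ ∀ i, g (r, i) ≠ none),
          ∃ i, g (r, i) = none := by
        intro r hr
        rw [Finset.mem_filter] at hr
        obtain ⟨-, h⟩ := hr
        simp only [ne_eq, not_forall, not_not] at h
        exact h
      refine Finset.card_le_card_of_injOn (fun r => (r, if h : ∃ i, g (r, i) = none then h.choose
        else 0)) ?_ ?_
      · intro r hr
        obtain h := key r hr
        rw [Finset.mem_coe, hUng, Finset.mem_filter]
        refine ⟨Finset.mem_univ _, ?_⟩
        simp only [dif_pos h]
        exact h.choose_spec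
      · intro r _ r' _ h
        exact (Prod.ext_iff.mp h).1
    omega
  rw [hWlen, hWmk] at hmain
  have e1 : 3 * T - Ung.card = 2 * M := by omega
  rw [e1]
  have e2 : 2 * ℓ * M = ℓ * (2 * M) := by ring
  rw [e2] at hmain
  omega

end GluedAssembly

end Literature.GroupTheory.CombinatorialGroupTheory
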